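import Mathlib
import HarnessLib
import Summits.HubbardSuperconductivity.HubbardSuperconductivity.Theses.ComplexGFFStiffness
import Summits.HubbardSuperconductivity.HubbardSuperconductivity.Theorems.ComplexGFFStiffnessHypACumulantSplitShrunk
import Summits.HubbardSuperconductivity.HubbardSuperconductivity.Theorems.ComplexGFFStiffnessTwoKernelSkBound
import Summits.HubbardSuperconductivity.HubbardSuperconductivity.Theorems.ComplexGFFStiffnessL2GaussianCore
import Summits.HubbardSuperconductivity.HubbardSuperconductivity.Theorems.ComplexGFFStiffnessF4StatementOfCores
import Summits.HubbardSuperconductivity.HubbardSuperconductivity.Theorems.ComplexGFFStiffnessH1bcStatement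
import Summits.HubbardSuperconductivity.HubbardSuperconductivity.Theorems.ComplexGFFStiffnessF1Residual

/-!
# Route `route-HubbardSuperconductivity-ComplexGFFStiffness`: the child `TwoPointGivenZ` (stmt-HubbardSuperconductivity-27383) HOLDS

The closer `twoPointGivenZ_item_of_cores` (p825920) applied to the five re-typed children, all landed:
`TwoKernelSkBound_proof` (this generation), `L2GaussianCore_proof`, `F4StatementOfCores_proof`, `H1bcStatement_proof`, `F1Residual_proof`.

* **`TwoPointGivenZ_proof`** — the route decl `Summit.….Theses.ComplexGFFStiffness.TwoPointGivenZ` BY NAME.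

All proved, no `sorry`.  Honest scope: rung route H2gff / 1c (stiffness of a complex Gaussian gradient field via the [ABKM19] RG); nothing
about superconductivity in the Hubbard model is claimed or advanced.

## References
* S. Adams, S. Buchholz, R. Kotecký, S. Müller, arXiv:1910.13564, Thm 2.2, Lemma 12.6 [AdamsBuchholzKoteckyMuller2019].
-/

noncomputable section

-- `Summit.<Summit>.<Problem>`: single-conjunct summit, the duplicate component is mandated (D-0017).
set_option linter.dupNamespace false

namespace Summit.HubbardSuperconductivity.HubbardSuperconductivity.Theorems

/-- **The child `TwoPointGivenZ` (stmt-HubbardSuperconductivity-27383) holds**: the local two-point bound given the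
non-vanishing normalisation, from the five re-typed cores. [cite: AdamsBuchholzKoteckyMuller2019, Thm 2.2 / Lemma 12.6] -/
theorem TwoPointGivenZ_proof :
    Summit.HubbardSuperconductivity.HubbardSuperconductivity.Theses.ComplexGFFStiffness.TwoPointGivenZ :=
  twoPointGivenZ_item_of_cores TwoKernelSkBound_proof L2GaussianCore_proof F4StatementOfCores_proof H1bcStatement_proof
    F1Residual_proof

end Summit.HubbardSuperconductivity.HubbardSuperconductivity.Theorems

end
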